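import Mathlib.Algebra.Colimit.Module
import Mathlib.GroupTheory.QuotientGroup.Basic
import Mathlib.NumberTheory.Padics.PadicIntegers
import HarnessLib

/-!
# Input (R1) of road T / road Λ to item 23110: EXISTENCE of a realization of `A ⊗ ℚ_p/ℤ_p` — the «divisible hull modulo `A`»
# `S = A[1/p]/A` with the maps `ι_k : A → S`, `x ↦ x/p^k`, for an abelian group `A` without `p`-torsion and an endomorphism `γ`

Routes `ResidualThetaTransportAtTwo` (RTT, crux r201 `ResidualLambdaFormulaNegDiscAtTwo`, stmt-BirchSwinnertonDyer-23110) /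
`ThetaPartnerAtTwo`. Seat `prover-bsd-wall-tp2-p2x-w2` g15; `--supports stmt-BirchSwinnertonDyer-23110`. THEOREMS ONLY, PURE ALGEBRA
(no definition, no named fact, no `sorry`): the realization is packaged as an EXISTENTIAL statement.

WHY. `PlusDual.nonempty_linearEquiv_of_hull` / `SignedEC.PlusDualTwo.nonempty_linearEquiv_iwasawaAlgebra_two` (p660566) prove
`(H⁺)^∨ ≅ Λ` at `2` for EVERY realization `(S, φ, ι_k)` of `A ⊗ ℚ_p/ℤ_p` satisfying five axioms (`ι 0 = 0`, `p·ι_{k+1} = ι_k`,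
`S = ⋃ im ι_k`, `ι_k x = 0 ⟹ x ∈ p^k A`, `φ ∘ ι_k = ι_k ∘ γ`). THIS FILE shows such a realization EXISTS for every abelian group `A`
without `p`-torsion and every additive `γ : A → A` (`exists_divisibleHull`): `S = (lim→ (A →ᵖ A →ᵖ A → ⋯)) / A` (Mathlib's
`AddCommGroup.DirectLimit` of the constant system with transition maps `p^{j−i}`, modulo the image of the `0`-th term — a model of `A[1/p]/A`),
`ι_k x = [x at stage k]` (= `x/p^k`), `φ` induced by `γ` stagewise (`DirectLimit.lift`). So the conclusion of (R1)
— and every count derived from it (`#(A/p^J A)^{γ = c}`, H-PLUSDUAL bricks (K1)/(K2)) — is available unconditionally.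

HONEST FRAMING: closes nothing; 23110 is NOT proved; BSD is not proved by any of this.
References: [BDKim2007] Prop. 3.17 (`(E^±(k_∞) ⊗ ℚ_p/ℤ_p)^∨`); [AtiyahMacdonald1969] Ch. 3 (modules of fractions).
-/

set_option autoImplicit false
-- D-0017: single-problem summit, so `Summit.BirchSwinnertonDyer.BirchSwinnertonDyer.…` repeats a namespace BY DESIGN.
set_option linter.dupNamespace false

noncomputable section

open scoped Classical

namespace Summit.BirchSwinnertonDyer.BirchSwinnertonDyer.Theorems.ResidualThetaLayer.PlusDual

universe u

/-- **The divisible hull modulo `A` exists.** For an abelian group `A` without `p`-torsion and an additive `γ : A → A` there are an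
abelian group `S` (namely `A[1/p]/A`), an endomorphism `φ` of `S` and additive maps `ι_k : A → S` (`x ↦ x/p^k mod A`) with:
`ι_0 = 0`; `p·ι_{k+1} x = ι_k x`; every `s ∈ S` is some `ι_k x`; `ι_k x = 0 ⟹ x = p^k w`; `φ (ι_k x) = ι_k (γ x)`.
(`S ≅ A ⊗ ℚ_p/ℤ_p`.) [cite: AtiyahMacdonald1969, Ch. 3 (Prop. 3.3, modules of fractions)] -/
theorem exists_divisibleHull {p : ℕ} [Fact p.Prime] (A : Type u) [AddCommGroup A] (hA : ∀ a : A, p • a = 0 → a = 0)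
    (γ : A →+ A) :
    ∃ (S : Type u) (_ : AddCommGroup S) (φ : S →+ S) (ι : ℕ → (A →+ S)),
      (∀ x, ι 0 x = 0) ∧ (∀ (k : ℕ) x, p • ι (k + 1) x = ι k x) ∧ (∀ s : S, ∃ (k : ℕ) (x : A), ι k x = s) ∧
      (∀ (k : ℕ) x, ι k x = 0 → ∃ w : A, x = p ^ k • w) ∧ (∀ (k : ℕ) x, φ (ι k x) = ι k (γ x)) := by
  classical
  -- the directed system `A →ᵖ A →ᵖ A → ⋯` (stage `k` = «`A · p^{-k}`»)
  let G : ℕ → Type u := fun _ ↦ A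
  let f : ∀ i j : ℕ, i ≤ j → G i →+ G j := fun i j _ ↦ p ^ (j - i) • AddMonoidHom.id A
  have hf : ∀ (i j : ℕ) (h : i ≤ j) (x : A), f i j h x = p ^ (j - i) • x := fun _ _ _ _ ↦ rfl
  haveI : DirectedSystem G fun i j h ↦ f i j h :=
    { map_self := fun i x ↦ by
        change p ^ (i - i) • x = x
        rw [Nat.sub_self, pow_zero, one_smul]
      map_map := fun k j i hij hjk x ↦ by
        change p ^ (k - j) • p ^ (j - i) • x = p ^ (k - i) • x
        rw [smul_smul, ← pow_add, show k - j + (j - i) = k - i by omega] }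
  let D := AddCommGroup.DirectLimit G f
  let of : ∀ k : ℕ, A →+ D := fun k ↦ AddCommGroup.DirectLimit.of G f k
  have hof : ∀ (i j : ℕ) (h : i ≤ j) (x : A), of j (p ^ (j - i) • x) = of i x := fun i j h x ↦
    AddCommGroup.DirectLimit.of_f (G := G) (f := f) h x
  -- no `p`-torsion, iterated
  have hcancel : ∀ (n : ℕ) (y : A), p ^ n • y = 0 → y = 0 := by
    intro n
    induction n with
    | zero => intro y hy; simpa using hy
    | succ n ih => intro y hy; rw [pow_succ, mul_smul] at hy; exact hA y (ih _ hy)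
  -- the subgroup `A = of 0 (A)` and the quotient `S`
  let N : AddSubgroup D := (of 0).range
  -- the endomorphism induced by `γ`
  let φD : D →+ D := AddCommGroup.DirectLimit.lift G f D (fun i ↦ (of i).comp γ) fun i j hij x ↦ by
    change of j (γ (p ^ (j - i) • x)) = of i (γ x)
    rw [map_nsmul, hof i j hij]
  have hφD : ∀ (k : ℕ) (x : A), φD (of k x) = of k (γ x) := fun k x ↦
    AddCommGroup.DirectLimit.lift_of (G := G) (f := f) _ _ _ k x
  have hN : N ≤ N.comap φD := by
    rintro _ ⟨a, rfl⟩
    exact ⟨γ a, (hφD 0 a).symm⟩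
  refine ⟨D ⧸ N, inferInstance, QuotientAddGroup.map N N φD hN, fun k ↦ (QuotientAddGroup.mk' N).comp (of k),
    ?_, ?_, ?_, ?_, ?_⟩
  · -- `ι 0 = 0`
    intro x
    change ((of 0 x : D) : D ⧸ N) = 0
    rw [QuotientAddGroup.eq_zero_iff]
    exact ⟨x, rfl⟩
  · -- `p · ι (k+1) x = ι k x`
    intro k x
    have h := hof k (k + 1) (Nat.le_succ k) x
    rw [show k + 1 - k = 1 by omega, pow_one] at h
    change p • (QuotientAddGroup.mk' N (of (k + 1) x)) = QuotientAddGroup.mk' N (of k x)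
    rw [← map_nsmul, ← map_nsmul, h]
  · -- surjectivity
    intro s
    obtain ⟨z, rfl⟩ := QuotientAddGroup.mk_surjective s
    induction z using AddCommGroup.DirectLimit.induction_on with
    | ih i x => exact ⟨i, x, rfl⟩
  · -- kernel
    intro k x hx
    change ((of k x : D) : D ⧸ N) = 0 at hx
    rw [QuotientAddGroup.eq_zero_iff] at hx
    obtain ⟨b, hb⟩ := hx
    -- `of k x = of 0 b = of k (p^k b)`, so `of k (x − p^k b) = 0`, so `p^{j-k} (x − p^k b) = 0`
    have h1 : of k (x - p ^ k • b) = 0 := by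
      rw [map_sub, ← hb, ← hof 0 k (Nat.zero_le k) b, Nat.sub_zero, sub_self]
    obtain ⟨j, hkj, hj⟩ := AddCommGroup.DirectLimit.of.zero_exact (G := G) (f := f) k _ h1
    change p ^ (j - k) • (x - p ^ k • b) = 0 at hj
    exact ⟨b, sub_eq_zero.mp (hcancel _ _ hj)⟩
  · -- equivariance
    intro k x
    rw [AddMonoidHom.comp_apply, AddMonoidHom.comp_apply, QuotientAddGroup.mk'_apply, QuotientAddGroup.mk'_apply,
      QuotientAddGroup.map_mk, hφD]

end Summit.BirchSwinnertonDyer.BirchSwinnertonDyer.Theorems.ResidualThetaLayer.PlusDual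

end
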